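import Literature.Topology.FourManifolds.SlideDiffeomorphism
import HarnessLib

/-!
# The slide formula with the feet read at the seed level

Topic `Literature/Topology/FourManifolds` (fact seat
`provefact-Literature.Topology.FourManifolds.lauden-f709dd520c`, Laudenbach–Poénaru's Lemma 2, the
slide `H₃`).  Everything here is **proved**; no named facts.

`SlideDiffeomorphism.lean` (Part 3) states the effect of the slide diffeomorphism `Ψ` on the
loop through the handle with the two distinguished points of `X = {f ≤ a - η}` taken on the
cut level `a - η`.  For the assembly it is more convenient to take them **on the seed level**
`f⁻¹(c) ⊆ X` itself: the centres `v₋`, `v₊` of the two flowed-down feet discs, where the track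
of the slide homotopy is the track of the seed diffeotopy read in `M`
(`SlideContext.levelTrack`), with no flow line in between.

* `SlideContext.levelPt v` — a point of the seed level as a point of `X`;
* `SlideContext.slideHomotopyFun_levelIncl` — the slide homotopy at a point of the seed level is
  `s ↦ ψ_s v`;
* `SlideContext.mapOfEq_slide_arcLoop_level` — **the slide formula**
  `Ψ_# [α₋ · K · α₊⁻¹] = [α₋ · K · α₊⁻¹] · [α₊ · λ₊ · α₊⁻¹]⁻¹` for paths `α± : x₀ ⟶ v±` in `X`,
  any path `K : v₋ ⟶ v₊` in `M` fixed pointwise by `Ψ`, and `λ₊ s = ψ_s v₊` the track of `v₊`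
  (every stage of `ψ` fixing `v₋`, the final one fixing `v₊`).

## References

* F. Laudenbach, V. Poénaru, *A note on 4-dimensional handlebodies*, Bull. Soc. Math. France
  100 (1972), proof of Lemma 2 (p. 340). [LaudenbachPoenaruBSMF1972]
* A. Hatcher, *Algebraic Topology* (2002), Lemma 1.19. [HatcherAT2002]
-/

open scoped Manifold ContDiff Topology unitInterval
open Set Function Filter Metric Module
open Literature.AlgebraicTopology.FundamentalGroup

noncomputable section

namespace Literature.Topology.FourManifolds

universe u

namespace SlideContext

variable {n : ℕ} {M : Type u} [TopologicalSpace M] [ChartedSpace (EuclideanHalfSpace (n + 1)) M]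
  [IsManifold (𝓡∂ (n + 1)) ∞ M] [T2Space M] (C : SlideContext n M)
  (ψ : Diffeotopy (𝓡 n) (C.toCtx.Sl'.Level (C.toCtx.c + C.toCtx.σ)))

/-- **A point of the seed level as a point of `X = {f ≤ a - η}`.** [folklore] -/
def levelPt (v : C.toCtx.Sl'.Level (C.toCtx.c + C.toCtx.σ)) : ↥(C.S.f ⁻¹' Iic C.cut) :=
  ⟨C.toCtx.Sl'.levelIncl v, by
    show C.S.f _ ≤ C.cut
    rw [C.apply_levelIncl v]; exact le_of_lt (lt_trans (by linarith [C.τ_pos]) C.cut_lt.1)⟩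

omit [T2Space M] in
/-- Unfolding. [folklore] -/
@[simp] theorem levelPt_coe (v : C.toCtx.Sl'.Level (C.toCtx.c + C.toCtx.σ)) : (C.levelPt v : M) = C.toCtx.Sl'.levelIncl v := rfl

omit [T2Space M] in
/-- **The slide homotopy at a point of the seed level** is the track of the seed diffeotopy:
`H (s, v) = ψ_s v`. [cite: HatcherAT2002, Lemma 1.19] -/
theorem slideHomotopyFun_levelIncl (s : ℝ) (v : C.toCtx.Sl'.Level (C.toCtx.c + C.toCtx.σ)) :
    C.slideHomotopyFun ψ s (C.toCtx.Sl'.levelIncl v) = C.toCtx.Sl'.levelIncl (ψ.toFun s v) := by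
  unfold slideHomotopyFun dropT
  rw [C.apply_levelIncl v, sub_self, max_eq_right le_rfl, neg_zero]
  simp only [C.S.isFlowOf.map_zero]
  exact C.suspFamily_levelIncl ψ s v

section Pi1

variable {C ψ}
variable {g g' : M → M} {η₀ : ℝ} {N : ℕ} (hη₀ : C.toCtx.S.η / 2 < η₀) (hη₀' : η₀ ≤ 2 * C.toCtx.S.η / 3)
  (hA : C.toCtx.c + C.toCtx.τ + N * η₀ = C.toCtx.S.a + 2 * η₀)
  (hP : IsLowerPair C.toCtx.Sl C.toCtx.Sl' C.toCtx.σ (C.toCtx.c + C.toCtx.τ + N * η₀) η₀ g g')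
  (hfeet : ∀ {s : ℝ} (hs : s ^ 2 = 1) (w : EuclideanSpace ℝ (Fin n)), ‖w‖ ≤ 1 → (s = 1 ∨ s = -1) →
    g (C.toCtx.S.D.foot s C.toCtx.m C.toCtx.ρ w) = C.toCtx.S'.D.foot s C.toCtx.m' C.toCtx.ρ w)
  {Ψ : M ≃ₘ⟮𝓡∂ (n + 1), 𝓡∂ (n + 1)⟯ M}
  (hbelow : ∀ x, C.S.f x < C.c → g x = C.susp ψ x)
  (hconj : ∀ x, C.c ≤ C.S.f x → C.S.f x < C.toCtx.c + C.toCtx.τ + N * η₀ →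
    g x = C.S.θ (C.S.f x - C.c, C.susp ψ (C.S.θ (C.c - C.S.f x, x))))
  (hΨ : ∀ x, C.S.f x ≤ C.S.ℓu - 3 * C.S.δ → Ψ x = (C.toCtx.pair hη₀ hη₀' hA hP hfeet).hetMap x)

include hbelow hconj hΨ in
/-- **The slide formula with the feet on the seed level** (Laudenbach–Poénaru's `H₃`, p. 340;
Hatcher's Lemma 1.19).  For every stage of `ψ` fixing `v₋`, the final one fixing `v₊`, paths
`α± : x₀ ⟶ v±` in `X` from a base point below `c - 3τ`, and a path `K : v₋ ⟶ v₊` in `M`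
fixed pointwise by `Ψ`:
`Ψ_# [α₋ · K · α₊⁻¹] = [α₋ · K · α₊⁻¹] · [α₊ · λ₊ · α₊⁻¹]⁻¹`, `λ₊ s = ψ_s v₊`.
[cite: LaudenbachPoenaruBSMF1972, §2, proof of Lemma 2 (p. 340)] [cite: HatcherAT2002, Lemma 1.19] -/
theorem mapOfEq_slide_arcLoop_level {x₀ : ↥(C.S.f ⁻¹' Iic C.cut)} (hx₀ : C.S.f x₀.1 ≤ C.c - 3 * C.τ)
    (hΨx₀ : slideMap Ψ (C.inclCut x₀) = C.inclCut x₀)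
    {vm vp : C.toCtx.Sl'.Level (C.toCtx.c + C.toCtx.σ)} (hvm : ∀ s, ψ.toFun s vm = vm) (hvp : ψ.toFun 1 vp = vp)
    (αm : Path x₀ (C.levelPt vm)) (αp : Path x₀ (C.levelPt vp))
    (K : Path (C.toCtx.Sl'.levelIncl vm) (C.toCtx.Sl'.levelIncl vp)) (hK : ∀ s, Ψ (K s) = K s) :
    FundamentalGroup.mapOfEq (slideMap Ψ) hΨx₀
        (FundamentalGroup.fromPath (Path.Homotopic.Quotient.mk
          (((αm.map (map_continuous C.inclCut)).trans K).trans (αp.map (map_continuous C.inclCut)).symm))) =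
      FundamentalGroup.fromPath
        ((Path.Homotopic.Quotient.mk
          (((αm.map (map_continuous C.inclCut)).trans K).trans (αp.map (map_continuous C.inclCut)).symm)).trans
         (Path.Homotopic.Quotient.mk
          (((αp.map (map_continuous C.inclCut)).trans (C.levelTrack ψ hvp)).trans
            (αp.map (map_continuous C.inclCut)).symm)).symm) := by
  refine IsotopyTrack.mapOfEq_mk_arcLoop_of_slide C.inclCut (slideMap Ψ)
    (C.slideHomotopy ψ (slideMap Ψ) (slide_hΦ hη₀ hη₀' hA hP hfeet hbelow hconj hΨ))
    (fun t => C.slideHomotopyFun_of_le ψ t hx₀) hΨx₀ αm αp K hK (fun t => ?_) (C.levelTrack ψ hvp) (fun t => ?_)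
  · show C.slideHomotopyFun ψ t (C.toCtx.Sl'.levelIncl vm) = C.toCtx.Sl'.levelIncl vm
    rw [C.slideHomotopyFun_levelIncl ψ t vm, hvm t]
  · exact C.slideHomotopyFun_levelIncl ψ t vp

end Pi1

end SlideContext

end Literature.Topology.FourManifolds
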